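import Summits.QuantumFields.BalabanUV.Beta.RemainderExplicitHistoryDiagonalWindow

/-!
# RemainderExplicitHistoryDiagonalComparison — ROAD P3, ORDER-0 PROFILE FAMILY: ALONG TWO INFRARED-PINNED RUNS THE MATCHED DISCREPANCY IS
# COMPARABLE AT ANY TWO POSITIONS WITH ONE CONSTANT — `d_{j′} ≤ d_j ∕ (1 − Wγ∕b)` for `j ≤ j′` (towards the pin), under the ultraviolet-half
# smallness `Wγ < b` alone; family form: `astar g m′ − invSq g m′ (n+m−m′) ≤ (astar g m − invSq g m n) ∕ (1 − Wγ∕b)` for every `m′ ≤ m`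
# (first file of station S-d4p3-g50-1 «the matched discrepancy is comparable along the run: uniform threshold and the pointwise lower side»)

Cell `pub-balaban`, β-function sub-cell, BINDER row D4 «RemainderConst leaves for Bałaban's split» (`HOME/BINDER-OWNERS.md`; owner
lineage `b2b-balaban-beta-an4`; this file by co-owner #3 lineage `b2b-balaban-beta-d4-p3`, road P3 «the reduction road», generation 50,
station S-d4p3-g50-1, first file; imports generation 49's `RemainderExplicitHistoryDiagonalWindow`), β-FLOW TEAM duty (1); FREEZE (0)
honoured (def-free module in road P3's own `RemainderExplicit*` series; no leaf, no interface, no Literature file).  SOURCE OF THE SHAPES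
ONLY: [Balaban1987RG1] (0.20) p. 256, (0.31) and Thm 2 p. 259, §5 p. 298.  Pure real analysis about ONE explicit toy family (ours).

HONEST FRAMING (page 1 of everything the β sub-cell writes).  *"Discharging BetaPertH makes Bałaban's UV stability UNCONDITIONAL — a real
constructive-QFT result; it is NOT the continuum limit and NOT the Clay problem."*  THIS FILE DISCHARGES NOTHING OF THE KIND.  It answers
generation 49's census questions (ii) «is the matched discrepancy `d_j = 1∕(g^B_{j+n})² − 1∕(g^A_j)²` of two pinned runs EXACTLY non-increasing
towards the pin?» and (iii) «a POINTWISE lower side».  ANSWER TO (ii) AS ASKED: NO — for two-age profiles `ρ = M₁δ_{a₁} + M₂δ_{a₂}` the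
discrepancy has genuine dips towards the pin already at `Wγ∕b = 0.09` (seat numerics `HOME/b2b-balaban-beta-d4-p3/g50/numerics/`: e.g.
`ρ(3) = 0.158`, `ρ(15) = 0.019`, `g_IR = 0.5`, `b = 1`, `K = 20`, `n = 1`: `d` falls from `2.24495·10⁻³` at infrared distance 6 to
`2.23810·10⁻³` at distance 14 and rises again — 40-digit arithmetic, residual `10⁻³⁶`; 251 of 720 random sparse pairs dip; single-age and
power profiles never did), so a constant `> 1` is NECESSARY in generation 49's sixth file.  BUT THE CONSTANT IS UNIFORM, NOT EXPONENTIAL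
(§1): the sixth file's step bound `d_{j+1} − d_j ≤ W·e_j` (`e_j = g^A_j − g^B_{j+n} ≥ 0`), telescoped over `[j, j′)` and priced by the cubic
conversion weight `e_t ≤ (g^A_t)³∕2·d_t` with the asymptotic-freedom budget `Σ_{t<K} (g^A_t)³ ≤ 2γ∕b`, gives `d_{j′} − d_j ≤ (Wγ∕b)·max_{[j,K]} d`;
bootstrapping the maximum, **`d_{j′} ≤ d_j∕(1 − Wγ∕b)` for all `j ≤ j′ ≤ K`** under the third file's own ultraviolet-half smallness `Wγ < b`
— the factor `(1 + Wγ³∕2)^{σ₀−m}` of the sixth file is replaced by the single constant `b∕(b − Wγ)` (second file of the station), and the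
running maximum of the fourth file's lower side is within the same constant of the pointwise value (second file).  Nothing of Bałaban's
(1.22) is asserted or constructed; row D4 class UNCHANGED (critical-path width 0; instance 0∕1; D4 DISCHARGE NO DATE); NOT B12 Thm 2, NOT
BetaPertH, NOT continuum, NOT Clay.  HONEST DEPENDENCY: continuum YM on T⁴ ⇐ BetaPertH ∧ nine spine estimates (0/9 proved); BetaPertH ⇐
(D1) ∧ (D4) ∧ CAP+tail; G-an2-4 gates asym, D1 and NE2/3/4.  ABSOLUTE RULE: nothing is cited as a fact.

WHAT IS PROVED ([folklore]; 0 sorry; 0 `def`; the family as the hypothesis `hβ` on an abstract `β : FlowStep.HBeta`, `ρ ≥ 0`, `b > 0`).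
* §1 (two pinned runs A: `K` steps, B: `K + n` steps) `disc_succ_sub_le` (`d_{j+1} − d_j ≤ W·e_j`), `disc_sub_le_sum_gap`
  (`d_{j′} − d_j ≤ W·Σ_{t∈[j,j′)} e_t`), `sum_gap_le` (`Σ_{t∈[j,j′)} e_t ≤ (γ∕b)·P` for any bound `P` of `d` on `[j, j′)`), `disc_le_disc_add`
  (`d_{j′} ≤ d_j + (Wγ∕b)·P`), **`disc_le_disc_div`** (`Wγ < b` ⇒ `d_{j′} ≤ d_j∕(1 − Wγ∕b)`, `j ≤ j′ ≤ K`), `max_disc_le_disc_div`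
  (the maximum of `d` over `[j, K]` is `≤ d_j∕(1 − Wγ∕b)`).
* §2 (a pinned family `K ↦ g K`) **`astar_sub_invSq_comparison`** (`m′ ≤ m` ⇒
  `astar g m′ − invSq g m′ (n+m−m′) ≤ (astar g m − invSq g m n)∕(1 − Wγ∕b)`: at a smaller infrared distance of the SAME run the continuum
  discrepancy is at most `b∕(b−Wγ)` times the one at distance `m`), `max_astar_sub_invSq_le` (the running maximum over `m′ ≤ m` likewise).
All letters NOT-IN-PRINT; `BetaFlowAsPrinted S` records a Markov β_n only ⇒ no junction of the as-printed interface changes.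
-/

noncomputable section

open Finset Filter Topology

namespace Summit.QuantumFields.BalabanUV.Beta.RemainderExplicitHistoryDiagonalComparison

open Literature.MathematicalPhysics.QuantumFieldTheory.Balaban1983to89
open Literature.MathematicalPhysics.QuantumFieldTheory.Balaban1983to89.FlowStep
open Literature.MathematicalPhysics.QuantumFieldTheory.Balaban1983to89.T4CouplingMatching
open Literature.MathematicalPhysics.QuantumFieldTheory.Balaban1983to89.T4ContinuumCoupling
open Summit.QuantumFields.BalabanUV.Beta.RemainderExplicitHistoryDiagonalMonotone
open Summit.QuantumFields.BalabanUV.Beta.RemainderExplicitHistoryDiagonalWeights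
open Summit.QuantumFields.BalabanUV.Beta.RemainderExplicitHistoryDiagonalTwoRun
open Summit.QuantumFields.BalabanUV.Beta.RemainderExplicitHistoryDiagonalWindow

variable {β : HBeta} {b γ W : ℝ} {ρ : ℕ → ℝ}

/-! ## §1 Two pinned runs: the discrepancy is comparable at any two positions -/

/-- ONE STEP TOWARDS THE PIN GAINS AT MOST `W·e_j`: two runs of the order-0 profile family (`b > 0`, `ρ ≥ 0`, `Σ_{a<N} ρ_a ≤ W`) — A: `K`
steps, B: `K + n` steps, positive couplings — pinned `g^A_K = g^B_{K+n}`; for `j < K`: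
`(1∕(g^B_{j+1+n})² − 1∕(g^A_{j+1})²) − (1∕(g^B_{j+n})² − 1∕(g^A_j)²) ≤ W·(g^A_j − g^B_{j+n})` — in the step identity
`d_j − d_{j+1} = E_j + Σ_{i≤j} ρ(j−i)(e_i − e_j)` (`…Window.disc_step_window`) the extra-age source `E_j` and the `e_i` are `≥ 0`.
[cite: Balaban1987RG1, (0.20) p.256 and Thm 2 p.259] -/
theorem disc_succ_sub_le
    (hβ : ∀ (k : ℕ) (p : Fin (k + 1) → ℝ),
      β k p = b + ∑ i : Fin (k + 1), ρ (k - i) * min (p (Fin.last k)) (|p (Fin.last k) - p i|))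
    (hb : 0 < b) (hρ0 : ∀ a, 0 ≤ ρ a) (hρW : ∀ n, ∑ a ∈ range n, ρ a ≤ W) {K n : ℕ} {gA gB : ℕ → ℝ}
    (hA : RGEqH K β gA) (hB : RGEqH (K + n) β gB) (hApos : ∀ k, k ≤ K → 0 < gA k)
    (hBpos : ∀ k, k ≤ K + n → 0 < gB k) (hpin : gA K = gB (K + n)) {j : ℕ} (hj : j < K) :
    (1 / (gB (j + 1 + n)) ^ 2 - 1 / (gA (j + 1)) ^ 2) - (1 / (gB (j + n)) ^ 2 - 1 / (gA j) ^ 2)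
      ≤ W * (gA j - gB (j + n)) := by
  have hstep := disc_step_window hβ hb hρ0 hA hB hApos hBpos hj
  have hdom := invSq_le_invSq_shift_run hβ hb hρ0 hA hB hApos hBpos hpin
  have he : ∀ i, i ≤ K → 0 ≤ gA i - gB (i + n) := fun i hi => by
    linarith [le_of_one_div_sq_le (hApos i hi) (hBpos (i + n) (by omega)) (hdom i hi)]
  -- the extra-age source is nonnegative
  have hE : 0 ≤ ∑ i ∈ range n, ρ (j + n - i) * (gB (j + n) - gB i) := by
    refine Finset.sum_nonneg fun i hi => mul_nonneg (hρ0 _) ?_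
    have hi' : i < n := Finset.mem_range.mp hi
    linarith [run_mono_orderZero hβ hb hρ0 hB hBpos (show i ≤ j + n by omega) (by omega)]
  -- the common ages' term is at least `−W·e_j`
  have hF : -(W * (gA j - gB (j + n)))
      ≤ ∑ i ∈ range (j + 1), ρ (j - i) * ((gA i - gB (i + n)) - (gA j - gB (j + n))) := by
    have hR : ∑ i ∈ range (j + 1), ρ (j - i) ≤ W := by
      have h' : ∑ i ∈ range (j + 1), ρ (j - i) = ∑ i ∈ range (j + 1), ρ i := by
        rw [← Finset.sum_range_reflect ρ (j + 1)]
        refine Finset.sum_congr rfl fun i hi => ?_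
        have hi' := Finset.mem_range.mp hi
        rw [show j + 1 - 1 - i = j - i by omega]
      rw [h']; exact hρW (j + 1)
    calc -(W * (gA j - gB (j + n))) ≤ -((∑ i ∈ range (j + 1), ρ (j - i)) * (gA j - gB (j + n))) := by
          have := he j hj.le; nlinarith
      _ = ∑ i ∈ range (j + 1), ρ (j - i) * (-(gA j - gB (j + n))) := by
          rw [Finset.sum_mul, ← Finset.sum_neg_distrib]; exact Finset.sum_congr rfl fun i _ => by ring
      _ ≤ ∑ i ∈ range (j + 1), ρ (j - i) * ((gA i - gB (i + n)) - (gA j - gB (j + n))) := by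
          refine Finset.sum_le_sum fun i hi => mul_le_mul_of_nonneg_left ?_ (hρ0 _)
          have hi' : i ≤ j := Nat.lt_succ_iff.mp (Finset.mem_range.mp hi)
          linarith [he i (hi'.trans hj.le)]
  linarith

/-- TELESCOPED: for `j ≤ j′ ≤ K`, `d_{j′} − d_j ≤ W·Σ_{t∈[j,j′)} (g^A_t − g^B_{t+n})`. [cite: Balaban1987RG1, (0.20) p.256 and Thm 2 p.259] -/
theorem disc_sub_le_sum_gap
    (hβ : ∀ (k : ℕ) (p : Fin (k + 1) → ℝ),
      β k p = b + ∑ i : Fin (k + 1), ρ (k - i) * min (p (Fin.last k)) (|p (Fin.last k) - p i|))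
    (hb : 0 < b) (hρ0 : ∀ a, 0 ≤ ρ a) (hρW : ∀ n, ∑ a ∈ range n, ρ a ≤ W) {K n : ℕ} {gA gB : ℕ → ℝ}
    (hA : RGEqH K β gA) (hB : RGEqH (K + n) β gB) (hApos : ∀ k, k ≤ K → 0 < gA k)
    (hBpos : ∀ k, k ≤ K + n → 0 < gB k) (hpin : gA K = gB (K + n)) {j j' : ℕ} (hjj' : j ≤ j') (hj' : j' ≤ K) :
    (1 / (gB (j' + n)) ^ 2 - 1 / (gA j') ^ 2) - (1 / (gB (j + n)) ^ 2 - 1 / (gA j) ^ 2)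
      ≤ W * ∑ t ∈ Ico j j', (gA t - gB (t + n)) := by
  induction j', hjj' using Nat.le_induction with
  | base => simp
  | succ j' hjj' ih =>
    have h1 := ih (Nat.le_of_succ_le hj')
    have h2 := disc_succ_sub_le hβ hb hρ0 hρW hA hB hApos hBpos hpin (j := j') (Nat.lt_of_succ_le hj')
    rw [Finset.sum_Ico_succ_top hjj', mul_add]
    rw [show j' + 1 + n = j' + 1 + n from rfl] at h2
    linarith

/-- THE WINDOW'S COUPLING GAPS ARE PRICED BY ANY BOUND OF THE DISCREPANCY: same two runs with couplings in ]0,γ] (`γ > 0`); if `d_t ≤ P`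
for every `t ∈ [j, j′)` (`j′ ≤ K`), then `Σ_{t∈[j,j′)} (g^A_t − g^B_{t+n}) ≤ (γ∕b)·P` (`e_t ≤ (g^A_t)³∕2·d_t` and the asymptotic-freedom budget
`Σ_{t<K} (g^A_t)³ ≤ 2γ∕b`, `…Weights.cube_le_weight` ∕ `sum_weights_lt_le`). [cite: Balaban1987RG1, (0.31) p.259] -/
theorem sum_gap_le
    (hβ : ∀ (k : ℕ) (p : Fin (k + 1) → ℝ),
      β k p = b + ∑ i : Fin (k + 1), ρ (k - i) * min (p (Fin.last k)) (|p (Fin.last k) - p i|))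
    (hb : 0 < b) (hγ : 0 < γ) (hρ0 : ∀ a, 0 ≤ ρ a) {K n : ℕ} {gA gB : ℕ → ℝ}
    (hA : RGEqH K β gA) (hB : RGEqH (K + n) β gB) (hAbox : ∀ k, k ≤ K → 0 < gA k ∧ gA k ≤ γ)
    (hBpos : ∀ k, k ≤ K + n → 0 < gB k) (hpin : gA K = gB (K + n)) {j j' : ℕ} (hj' : j' ≤ K) {P : ℝ}
    (hP : ∀ t, j ≤ t → t < j' → 1 / (gB (t + n)) ^ 2 - 1 / (gA t) ^ 2 ≤ P) (hP0 : 0 ≤ P) :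
    ∑ t ∈ Ico j j', (gA t - gB (t + n)) ≤ γ / b * P := by
  have hApos : ∀ k, k ≤ K → 0 < gA k := fun k hk => (hAbox k hk).1
  have hlo : BetaLowerH b γ β :=
    RemainderExplicitHistoryHalfMomentWitness.lower (γ := γ) (lam := fun k i => ρ (k - i)) hβ (fun k i => hρ0 _)
  have hdom := invSq_le_invSq_shift_run hβ hb hρ0 hA hB hApos hBpos hpin
  have hBA : ∀ i, i ≤ K → gB (i + n) ≤ gA i := fun i hi =>
    le_of_one_div_sq_le (hApos i hi) (hBpos (i + n) (by omega)) (hdom i hi)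
  calc ∑ t ∈ Ico j j', (gA t - gB (t + n)) ≤ ∑ t ∈ Ico j j', (gA t) ^ 3 / 2 * P := by
        refine Finset.sum_le_sum fun t ht => ?_
        have ht' := Finset.mem_Ico.mp ht
        have htK : t ≤ K := by omega
        exact (gap_le_cube_mul (hBpos (t + n) (by omega)) (hBA t htK)).trans
          (mul_le_mul_of_nonneg_left (hP t ht'.1 ht'.2) (by have := hApos t htK; positivity))
    _ ≤ ∑ t ∈ range K, (gA t) ^ 3 / 2 * P :=
        Finset.sum_le_sum_of_subset_of_nonneg (fun t ht => Finset.mem_range.mpr (by have := (Finset.mem_Ico.mp ht).2; omega))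
          fun t ht _ => by have := hApos t (Finset.mem_range.mp ht).le; positivity
    _ = P / 2 * ∑ t ∈ range K, (gA t) ^ 3 := by rw [Finset.mul_sum]; exact Finset.sum_congr rfl fun t _ => by ring
    _ ≤ P / 2 * (2 * γ / b) := by
        refine mul_le_mul_of_nonneg_left ?_ (by positivity)
        calc ∑ t ∈ range K, (gA t) ^ 3 ≤ ∑ t ∈ range K, 1 / (sprof γ b (K - t)) ^ 2 * (1 / sprof γ b (K - t)) :=
              Finset.sum_le_sum fun t ht => cube_le_weight hγ hb hA hAbox hlo (Finset.mem_range.mp ht).le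
          _ ≤ 2 * γ / b := sum_weights_lt_le hγ hb K
    _ = γ / b * P := by ring

/-- `d_{j′} ≤ d_j + (Wγ∕b)·P` whenever `d ≤ P` on `[j, j′)` (`j ≤ j′ ≤ K`; `P ≥ 0`). [cite: Balaban1987RG1, (0.20) p.256, (0.31) and Thm 2 p.259] -/
theorem disc_le_disc_add
    (hβ : ∀ (k : ℕ) (p : Fin (k + 1) → ℝ),
      β k p = b + ∑ i : Fin (k + 1), ρ (k - i) * min (p (Fin.last k)) (|p (Fin.last k) - p i|))
    (hb : 0 < b) (hγ : 0 < γ) (hρ0 : ∀ a, 0 ≤ ρ a) (hρW : ∀ n, ∑ a ∈ range n, ρ a ≤ W) {K n : ℕ} {gA gB : ℕ → ℝ}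
    (hA : RGEqH K β gA) (hB : RGEqH (K + n) β gB) (hAbox : ∀ k, k ≤ K → 0 < gA k ∧ gA k ≤ γ)
    (hBpos : ∀ k, k ≤ K + n → 0 < gB k) (hpin : gA K = gB (K + n)) {j j' : ℕ} (hjj' : j ≤ j') (hj' : j' ≤ K) {P : ℝ}
    (hP : ∀ t, j ≤ t → t < j' → 1 / (gB (t + n)) ^ 2 - 1 / (gA t) ^ 2 ≤ P) (hP0 : 0 ≤ P) :
    1 / (gB (j' + n)) ^ 2 - 1 / (gA j') ^ 2 ≤ (1 / (gB (j + n)) ^ 2 - 1 / (gA j) ^ 2) + W * γ / b * P := by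
  have hApos : ∀ k, k ≤ K → 0 < gA k := fun k hk => (hAbox k hk).1
  have hW : 0 ≤ W := by simpa using hρW 0
  have h1 := disc_sub_le_sum_gap hβ hb hρ0 hρW hA hB hApos hBpos hpin hjj' hj'
  have h2 := sum_gap_le hβ hb hγ hρ0 hA hB hAbox hBpos hpin hj' hP hP0
  have h3 := mul_le_mul_of_nonneg_left h2 hW
  have e : W * (γ / b * P) = W * γ / b * P := by ring
  linarith

/-- **THE MATCHED DISCREPANCY IS COMPARABLE ALONG THE RUN.**  Two runs of the order-0 profile family in ]0,γ] (`b > 0`, `γ > 0`, `ρ ≥ 0`,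
`Σ_{a<N} ρ_a ≤ W`) — A: `K` steps, B: `K + n` steps — pinned `g^A_K = g^B_{K+n}`, under the ultraviolet-half smallness `Wγ < b`.  THEN for all
`j ≤ j′ ≤ K`: `1∕(g^B_{j′+n})² − 1∕(g^A_{j′})² ≤ (1∕(g^B_{j+n})² − 1∕(g^A_j)²) ∕ (1 − Wγ∕b)` — towards the pin the discrepancy grows by at most the
ONE factor `b∕(b − Wγ)`, however many steps (the maximum `P` of `d` over `[j, K]`, attained at `t⋆`, satisfies `P ≤ d_j + (Wγ∕b)·P` by
`disc_le_disc_add` at `t⋆`).  Exact monotonicity (`factor = 1`) is FALSE for two-age profiles (seat numerics, header).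
[cite: Balaban1987RG1, (0.20) p.256, (0.31) and Thm 2 p.259] -/
theorem disc_le_disc_div
    (hβ : ∀ (k : ℕ) (p : Fin (k + 1) → ℝ),
      β k p = b + ∑ i : Fin (k + 1), ρ (k - i) * min (p (Fin.last k)) (|p (Fin.last k) - p i|))
    (hb : 0 < b) (hγ : 0 < γ) (hρ0 : ∀ a, 0 ≤ ρ a) (hρW : ∀ n, ∑ a ∈ range n, ρ a ≤ W) (hsmall : W * γ < b) {K n : ℕ}
    {gA gB : ℕ → ℝ} (hA : RGEqH K β gA) (hB : RGEqH (K + n) β gB) (hAbox : ∀ k, k ≤ K → 0 < gA k ∧ gA k ≤ γ)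
    (hBpos : ∀ k, k ≤ K + n → 0 < gB k) (hpin : gA K = gB (K + n)) {j j' : ℕ} (hjj' : j ≤ j') (hj' : j' ≤ K) :
    1 / (gB (j' + n)) ^ 2 - 1 / (gA j') ^ 2 ≤ (1 / (gB (j + n)) ^ 2 - 1 / (gA j) ^ 2) / (1 - W * γ / b) := by
  classical
  have hApos : ∀ k, k ≤ K → 0 < gA k := fun k hk => (hAbox k hk).1
  have hdom := invSq_le_invSq_shift_run hβ hb hρ0 hA hB hApos hBpos hpin
  have hc : 0 < 1 - W * γ / b := by
    have : W * γ / b < 1 := (div_lt_one hb).mpr hsmall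
    linarith
  set d : ℕ → ℝ := fun t => 1 / (gB (t + n)) ^ 2 - 1 / (gA t) ^ 2 with hd
  have hd0 : ∀ t, t ≤ K → 0 ≤ d t := fun t ht => by have := hdom t ht; simp only [hd]; linarith
  -- the maximum of `d` over `[j, K]`
  obtain ⟨ts, hts, hmax⟩ := Finset.exists_max_image (Icc j K) d ⟨j, Finset.mem_Icc.mpr ⟨le_rfl, hjj'.trans hj'⟩⟩
  have hts' := Finset.mem_Icc.mp hts
  have hPmax : ∀ t, j ≤ t → t < ts → d t ≤ d ts := fun t h1 h2 => hmax t (Finset.mem_Icc.mpr ⟨h1, by omega⟩)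
  have hboot := disc_le_disc_add hβ hb hγ hρ0 hρW hA hB hAbox hBpos hpin hts'.1 hts'.2 hPmax (hd0 ts hts'.2)
  -- `P ≤ d_j + (Wγ∕b)·P`, so `P ≤ d_j∕(1 − Wγ∕b)`
  have hP : d ts ≤ d j / (1 - W * γ / b) := by
    rw [le_div_iff₀ hc]
    have : d ts ≤ d j + W * γ / b * d ts := hboot
    nlinarith
  exact (hmax j' (Finset.mem_Icc.mpr ⟨hjj', hj'⟩)).trans hP

/-- The same for the MAXIMUM over `[j, K]`: every `d_{j′}`, `j ≤ j′ ≤ K`, is `≤ d_j∕(1 − Wγ∕b)`; in particular so is their maximum (stated for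
any `t` in the window, for use under binders). [cite: Balaban1987RG1, (0.20) p.256, (0.31) and Thm 2 p.259] -/
theorem max_disc_le_disc_div
    (hβ : ∀ (k : ℕ) (p : Fin (k + 1) → ℝ),
      β k p = b + ∑ i : Fin (k + 1), ρ (k - i) * min (p (Fin.last k)) (|p (Fin.last k) - p i|))
    (hb : 0 < b) (hγ : 0 < γ) (hρ0 : ∀ a, 0 ≤ ρ a) (hρW : ∀ n, ∑ a ∈ range n, ρ a ≤ W) (hsmall : W * γ < b) {K n : ℕ}
    {gA gB : ℕ → ℝ} (hA : RGEqH K β gA) (hB : RGEqH (K + n) β gB) (hAbox : ∀ k, k ≤ K → 0 < gA k ∧ gA k ≤ γ)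
    (hBpos : ∀ k, k ≤ K + n → 0 < gB k) (hpin : gA K = gB (K + n)) (j : ℕ) :
    ∀ t ∈ Icc j K, 1 / (gB (t + n)) ^ 2 - 1 / (gA t) ^ 2 ≤ (1 / (gB (j + n)) ^ 2 - 1 / (gA j) ^ 2) / (1 - W * γ / b) :=
  fun _ ht => disc_le_disc_div hβ hb hγ hρ0 hρW hsmall hA hB hAbox hBpos hpin (Finset.mem_Icc.mp ht).1 (Finset.mem_Icc.mp ht).2

/-! ## §2 A pinned family: the continuum discrepancy at two infrared distances of the same run -/

/-- **ROAD P3 — THE CONTINUUM DISCREPANCY IS COMPARABLE ALONG EACH RUN.**  A family `K ↦ g K` of runs of the order-0 profile family in ]0,γ]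
pinned at one `g_IR` (`b > 0`, `γ > 0`, `ρ ≥ 0`, `Σ_{a<N} ρ_a ≤ W`, `Wγ < b`).  THEN for all infrared distances `m′ ≤ m` and every cutoff `n`:
`0 ≤ astar g m′ − invSq g m′ (n + m − m′)` and `astar g m′ − invSq g m′ (n + m − m′) ≤ (astar g m − invSq g m n) ∕ (1 − Wγ∕b)` — on the run
with `n + m` steps the distance of the lattice recursion variable from its continuum limit at infrared distance `m′` is at most `b∕(b−Wγ)`
times the one at the larger distance `m` (`disc_le_disc_div` for the pairs (run `n+m`, run `n+m+n′`) at the positions `n ≤ n+m−m′`, then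
`n′ → ∞` by `…Monotone.continuum_monotone` ∕ `invSq_mono`). [cite: Balaban1987RG1, (0.20) p.256, (0.31) and Thm 2 p.259] -/
theorem astar_sub_invSq_comparison
    (hβ : ∀ (k : ℕ) (p : Fin (k + 1) → ℝ),
      β k p = b + ∑ i : Fin (k + 1), ρ (k - i) * min (p (Fin.last k)) (|p (Fin.last k) - p i|))
    (hb : 0 < b) (hγ : 0 < γ) (hρ0 : ∀ a, 0 ≤ ρ a) (hρW : ∀ n, ∑ a ∈ range n, ρ a ≤ W) (hsmall : W * γ < b)
    {g : ℕ → ℕ → ℝ} {gIR : ℝ} (hrun : ∀ K, RGEqH K β (g K)) (hbox : ∀ K i, i ≤ K → 0 < g K i ∧ g K i ≤ γ)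
    (hpin : ∀ K, g K K = gIR) {m' m : ℕ} (hm' : m' ≤ m) (n : ℕ) :
    0 ≤ astar g m' - invSq g m' (n + m - m')
      ∧ astar g m' - invSq g m' (n + m - m') ≤ (astar g m - invSq g m n) / (1 - W * γ / b) := by
  have ht : ∀ k, Tendsto (invSq g k) atTop (𝓝 (astar g k)) := (continuum_monotone hβ hb hγ hρ0 hρW hrun hbox hpin).1
  have hmono := fun k => invSq_mono hβ hb hρ0 hrun hbox hpin k
  have hc : 0 < 1 - W * γ / b := by
    have : W * γ / b < 1 := (div_lt_one hb).mpr hsmall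
    linarith
  have h0 : invSq g m' (n + m - m') ≤ astar g m' := (hmono m').ge_of_tendsto (ht m') _
  have h1 : invSq g m n ≤ astar g m := (hmono m).ge_of_tendsto (ht m) n
  set C : ℝ := (astar g m - invSq g m n) / (1 - W * γ / b) with hC
  -- the bound between the cutoffs, pair by pair
  have hpair : ∀ n', invSq g m' (n + m - m' + n') - invSq g m' (n + m - m') ≤ C := by
    intro n'
    have hpin' : g (n + m) (n + m) = g (n + m + n') (n + m + n') := by rw [hpin, hpin]
    have hcmp := disc_le_disc_div hβ hb hγ hρ0 hρW hsmall (hrun (n + m)) (hrun (n + m + n')) (hbox (n + m))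
      (fun k hk => (hbox (n + m + n') k hk).1) hpin' (j := n) (j' := n + m - m') (by omega) (by omega)
    have eA : invSq g m' (n + m - m' + n') = 1 / (g (n + m + n') (n + m - m' + n')) ^ 2 := by
      rw [invSq_def, show n + m - m' + n' + m' = n + m + n' by omega]
    have eB : invSq g m' (n + m - m') = 1 / (g (n + m) (n + m - m')) ^ 2 := by
      rw [invSq_def, show n + m - m' + m' = n + m by omega]
    have eC : invSq g m (n + n') = 1 / (g (n + m + n') (n + n')) ^ 2 := by
      rw [invSq_def, show n + n' + m = n + m + n' by omega]
    have h2 : invSq g m (n + n') - invSq g m n ≤ astar g m - invSq g m n := by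
      linarith [(hmono m).ge_of_tendsto (ht m) (n + n')]
    rw [eA, eB]
    refine hcmp.trans ?_
    rw [← eC, ← invSq_def]
    exact div_le_div_of_nonneg_right h2 hc.le
  have hev : ∀ᶠ k in atTop, invSq g m' k ≤ invSq g m' (n + m - m') + C := by
    refine Filter.eventually_atTop.mpr ⟨n + m - m', fun k hk => ?_⟩
    obtain ⟨n', rfl⟩ := Nat.exists_eq_add_of_le hk
    linarith [hpair n']
  have h2 : astar g m' ≤ invSq g m' (n + m - m') + C := le_of_tendsto (ht m') hev
  constructor <;> linarith

/-- THE RUNNING MAXIMUM IS WITHIN THE SAME CONSTANT: under the hypotheses of `astar_sub_invSq_comparison`, every `m′ ≤ m` has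
`astar g m′ − invSq g m′ (n+m−m′) ≤ (astar g m − invSq g m n)∕(1 − Wγ∕b)`; so any lower bound holding for SOME `m′ ≤ m` (the fourth file's
`astar_sub_invSq_rate_lower` and its instances) holds at `m` itself up to the factor `b∕(b − Wγ)` — the POINTWISE lower side (second file).
[cite: Balaban1987RG1, (0.20) p.256, (0.31) and Thm 2 p.259] -/
theorem max_astar_sub_invSq_le
    (hβ : ∀ (k : ℕ) (p : Fin (k + 1) → ℝ),
      β k p = b + ∑ i : Fin (k + 1), ρ (k - i) * min (p (Fin.last k)) (|p (Fin.last k) - p i|))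
    (hb : 0 < b) (hγ : 0 < γ) (hρ0 : ∀ a, 0 ≤ ρ a) (hρW : ∀ n, ∑ a ∈ range n, ρ a ≤ W) (hsmall : W * γ < b)
    {g : ℕ → ℕ → ℝ} {gIR : ℝ} (hrun : ∀ K, RGEqH K β (g K)) (hbox : ∀ K i, i ≤ K → 0 < g K i ∧ g K i ≤ γ)
    (hpin : ∀ K, g K K = gIR) (m n : ℕ) {L : ℝ}
    (hL : ∃ m', m' ≤ m ∧ L ≤ astar g m' - invSq g m' (n + m - m')) :
    L ≤ (astar g m - invSq g m n) / (1 - W * γ / b) := by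
  obtain ⟨m', hm', hLm'⟩ := hL
  exact hLm'.trans (astar_sub_invSq_comparison hβ hb hγ hρ0 hρW hsmall hrun hbox hpin hm' n).2

end Summit.QuantumFields.BalabanUV.Beta.RemainderExplicitHistoryDiagonalComparison

end
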